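import Summits.QuantumFields.QCD.Theses.SmallBetaInfraredSplit
import Summits.QuantumFields.QCD.Theorems.SmallBetaInfraredSplitTwoPointKernelStructure
import Literature.MathematicalPhysics.QuantumLattice.StaggeredMasslessDeterminant
import Literature.MathematicalPhysics.StatisticalMechanics.InfraredBoundSpectralStep

/-!
# Route `SmallBetaInfraredSplit` (sub QCD) — glue item `IRBoundOfGaussianDomination` (stmt-QuantumFields-23767), PROVED

`GaussianDominationSmallBeta → WickSecondVariation → IRBoundSmallBeta` (LINE 9 of ideator `ym-idea-2` g9: the
β-stable infrared bound (crux `IRBoundSmallBeta`, 27240) from β-stable Gaussian domination of the mass-source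
generating functional (23765) and the identification of its second variation with the Wick kernel (23766)).

Proof = the classical second-order expansion (Fröhlich–Simon–Spencer 1976; Salmhofer–Seiler 1991, proof of
Thm. 3.21) in three steps, all at fixed `N, ν, β, L`:
* SECOND VARIATION (`coeff_two_le_of_eval_le_mul_exp`, elementary real analysis): Gaussian domination along the
  ray `s • φ` reads `p(s) ≤ Z_β · exp(c s²)` for the real polynomial `p` of `WickSecondVariation`, with
  `p(0) = Z_β ≥ 0` and `c = κ (φ,−Δφ)/2`, `κ = (2N)²(1/N + Cβ)`; adding the inequalities at `s = ±t` and letting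
  `t → 0⁺` gives `p₂ ≤ Z_β c` (no first-order information is needed);
* `p₂ = ½ ΣΣ (−Δφ)_x (−Δφ)_y ∫ Re det D₀ · Re W_xy` (`WickSecondVariation`) and `Z_β > 0` (tree:
  `StrongCoupling.integral_det_D0_re_wilsonWeight_pos`) turn this into the Gaussian-domination FORM of the infrared
  bound, `ΣΣ (−Δφ)_x G_β(x,y) (−Δφ)_y ≤ κ (φ, −Δφ)` for every real `φ`;
* SPECTRAL STEP (tree: `ComplexSpin.form_le_of_stencil_form_le`, characters of the torus + Parseval), using the
  symmetry and translation invariance of `G_β` at every `β` (tree: `twoPointKernelStructure_proof`):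
  `ΣΣ h(x) (−Δh)(y) G_β(x,y) ≤ κ ‖h‖²`.

HONEST FRAMING: glue only.  The crux `GaussianDominationSmallBeta` (23765), `NeighbourFloorSmallBeta` (27241), the
leaf `SalmhoferSeilerSmallBeta` (LADDER-YM rung Q1, RECORD label) stay OPEN and the route is DRAFT by design; nothing
about `QCD`, `YangMills`, a mass gap or a continuum limit is proved here.
[cite: SalmhoferSeiler1991, Thm. 3.21 (3.74), (3.95)–(3.99); FrohlichSimonSpencer1976]
-/

set_option autoImplicit false

namespace Summit.QuantumFields.QCD.Theorems.SmallBetaInfraredSplit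

open MeasureTheory Matrix Complex Finset Filter Polynomial
open Literature.MathematicalPhysics.QuantumFieldTheory
open Literature.MathematicalPhysics.QuantumLattice
open Literature.MathematicalPhysics.StatisticalMechanics
open Literature.MathematicalPhysics.StatisticalMechanics.ComplexSpin
open Literature.Probability.LatticeModels (TorusSite)
open scoped Topology

section SecondVariation

/-- Third-order Taylor form of a polynomial at `0`: `p(s) = p₀ + p₁ s + p₂ s² + s³ r(s)` with
`r = ((p.divX).divX).divX`. [folklore] -/
theorem eval_eq_taylor_three (p : ℝ[X]) (s : ℝ) :
    p.eval s = p.coeff 0 + p.coeff 1 * s + p.coeff 2 * s ^ 2 + (p.divX.divX.divX).eval s * s ^ 3 := by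
  have e0 : p.eval s = p.divX.eval s * s + p.coeff 0 := by
    conv_lhs => rw [← Polynomial.divX_mul_X_add p]
    rw [eval_add, eval_mul, eval_X, eval_C]
  have e1 : p.divX.eval s = p.divX.divX.eval s * s + p.coeff 1 := by
    conv_lhs => rw [← Polynomial.divX_mul_X_add p.divX]
    rw [eval_add, eval_mul, eval_X, eval_C, coeff_divX]
  have e2 : p.divX.divX.eval s = p.divX.divX.divX.eval s * s + p.coeff 2 := by
    conv_lhs => rw [← Polynomial.divX_mul_X_add p.divX.divX]
    rw [eval_add, eval_mul, eval_X, eval_C, coeff_divX, coeff_divX]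
  rw [e0, e1, e2]
  ring

/-- **Second variation of a Gaussian-domination bound** (elementary): if a real polynomial `p` with
`p(0) = Z ≥ 0` satisfies `p(s) ≤ Z·exp(c s²)` for all real `s`, then its second coefficient obeys `p₂ ≤ Z c`.
(Add the inequalities at `s = ±t`: the odd part drops out, `2p₂t² + O(t³) ≤ 2Z(exp(ct²) − 1) = 2Zct² + O(t⁴)`,
and let `t → 0⁺`.) [cite: FrohlichSimonSpencer1976, §3] -/
theorem coeff_two_le_of_eval_le_mul_exp {p : ℝ[X]} {Z c : ℝ} (hZ : 0 ≤ Z) (h0 : p.coeff 0 = Z)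
    (hle : ∀ s : ℝ, p.eval s ≤ Z * Real.exp (c * s ^ 2)) : p.coeff 2 ≤ Z * c := by
  set r := p.divX.divX.divX with hr
  -- a bound for the remainder on `[-1, 1]`
  obtain ⟨M, hM⟩ := (isCompact_Icc : IsCompact (Set.Icc (-1 : ℝ) 1)).exists_bound_of_continuousOn
    (r.continuous.continuousOn)
  have hM0 : 0 ≤ M := le_trans (norm_nonneg _) (hM 0 ⟨by norm_num, by norm_num⟩)
  -- the key estimate for small positive `t`
  set δ : ℝ := min 1 (1 / (|c| + 1)) with hδ
  have hδpos : 0 < δ := lt_min one_pos (by positivity)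
  have key : ∀ t : ℝ, 0 < t → t < δ → p.coeff 2 ≤ Z * c + (Z * c ^ 2 * t ^ 2 + M * t) := by
    intro t ht htδ
    have ht1 : t ≤ 1 := (htδ.le.trans (min_le_left _ _))
    have htc : t ≤ 1 / (|c| + 1) := htδ.le.trans (min_le_right _ _)
    have hct : |c * t ^ 2| ≤ 1 := by
      rw [abs_mul, abs_of_nonneg (by positivity : (0 : ℝ) ≤ t ^ 2)]
      have h1 : t ^ 2 ≤ t := by nlinarith
      have h2 : |c| * t ≤ |c| * (1 / (|c| + 1)) := mul_le_mul_of_nonneg_left htc (abs_nonneg c)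
      have h3 : |c| * (1 / (|c| + 1)) ≤ 1 := by
        rw [mul_one_div, div_le_one (by positivity)]; linarith [abs_nonneg c]
      nlinarith [abs_nonneg c]
    have hexp : Real.exp (c * t ^ 2) ≤ 1 + c * t ^ 2 + (c * t ^ 2) ^ 2 := by
      have := (abs_le.1 (Real.abs_exp_sub_one_sub_id_le hct)).2; linarith
    have hZexp : Z * Real.exp (c * t ^ 2) ≤ Z * (1 + c * t ^ 2 + (c * t ^ 2) ^ 2) :=
      mul_le_mul_of_nonneg_left hexp hZ
    have h1 := hle t
    have h2 := hle (-t)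
    rw [eval_eq_taylor_three, h0] at h1 h2
    rw [neg_sq] at h2
    have hr1 : |r.eval t| ≤ M := by simpa [Real.norm_eq_abs] using hM t ⟨by linarith, ht1⟩
    have hr2 : |r.eval (-t)| ≤ M := by simpa [Real.norm_eq_abs] using hM (-t) ⟨by linarith, by linarith⟩
    have ht3 : 0 < t ^ 3 := by positivity
    have hb1 : -(M * t ^ 3) ≤ r.eval t * t ^ 3 := by nlinarith [(abs_le.1 hr1).1]
    have hb2 : -(M * t ^ 3) ≤ -(r.eval (-t) * t ^ 3) := by nlinarith [(abs_le.1 hr2).2]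
    -- add the two inequalities: the odd part cancels
    have hsum : 2 * (p.coeff 2 * t ^ 2) - 2 * (M * t ^ 3) ≤
        2 * (Z * (c * t ^ 2) + Z * (c * t ^ 2) ^ 2) := by
      have e2 : (-t) ^ 3 = -(t ^ 3) := by ring
      rw [e2] at h2
      nlinarith [h1, h2, hZexp, hb1, hb2]
    have ht2 : 0 < t ^ 2 := by positivity
    have : p.coeff 2 * t ^ 2 ≤ (Z * c + (Z * c ^ 2 * t ^ 2 + M * t)) * t ^ 2 := by nlinarith [hsum]
    exact le_of_mul_le_mul_right this ht2
  -- let `t → 0⁺`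
  have hlim : Tendsto (fun t : ℝ => Z * c + (Z * c ^ 2 * t ^ 2 + M * t)) (𝓝[>] 0) (𝓝 (Z * c)) := by
    have : Tendsto (fun t : ℝ => Z * c + (Z * c ^ 2 * t ^ 2 + M * t)) (𝓝 0)
        (𝓝 (Z * c + (Z * c ^ 2 * 0 ^ 2 + M * 0))) :=
      ((continuous_const.add ((continuous_const.mul (continuous_pow 2)).add
        (continuous_const.mul continuous_id))).tendsto 0)
    simpa using this.mono_left nhdsWithin_le_nhds
  refine ge_of_tendsto hlim ?_
  have hev : ∀ᶠ t in 𝓝[>] (0 : ℝ), t < δ :=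
    (nhdsWithin_le_nhds (Iio_mem_nhds hδpos))
  filter_upwards [hev, self_mem_nhdsWithin] with t htδ ht
  exact key t ht htδ

end SecondVariation

section Laplacian

variable {ν L : ℕ}

/-- The lattice Laplacean is linear: `−Δ(s•φ) = s·(−Δφ)`. [folklore] -/
theorem neg_laplacian_smul (s : ℝ) (φ : TorusSite ν L → ℝ) (x : TorusSite ν L) :
    -laplacian (s • φ) x = s * (-laplacian φ x) := by
  unfold laplacian
  simp only [Pi.smul_apply, smul_eq_mul]
  rw [← Finset.sum_neg_distrib, ← Finset.sum_neg_distrib, Finset.mul_sum]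
  exact Finset.sum_congr rfl fun μ _ => by ring

end Laplacian

/-- The route's glue item `IRBoundOfGaussianDomination` (stmt-QuantumFields-23767) BY NAME:
`GaussianDominationSmallBeta → WickSecondVariation → IRBoundSmallBeta` — second variation of Gaussian
domination along `s • φ`, positivity of `Z_β`, and the torus spectral step.
[cite: SalmhoferSeiler1991, Thm. 3.21 (3.74), (3.95)–(3.99)] -/
theorem irBoundOfGaussianDomination_proof :
    Summit.QuantumFields.QCD.Theses.SmallBetaInfraredSplit.IRBoundOfGaussianDomination := by
  intro hGD hW N ν hN1 hN4 hν
  obtain ⟨β₀, hβ₀, C, hC, hGD'⟩ := hGD N ν hN1 hN4 hν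
  refine ⟨β₀, hβ₀, C, hC, fun β hβ hββ₀ L _ hL hL4 h => ?_⟩
  haveI : NeZero ν := ⟨by omega⟩
  -- names
  set κ : ℝ := (2 * N : ℝ) ^ 2 * (1 / N + C * β) with hκdef
  set Z : ℝ := ∫ U, (Matrix.det (staggeredDirac (unitaryFundamentalRep (Fin N) ℂ) U 0)).re
    ∂(wilsonWeight (d := ν) (L := L) (unitaryFundamentalRep (Fin N) ℂ) β) with hZdef
  set K : TorusSite ν L → TorusSite ν L → ℝ := fun x y =>
    (∫ U, (Matrix.det (staggeredDirac (unitaryFundamentalRep (Fin N) ℂ) U 0)).re *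
      (let G := (staggeredDirac (unitaryFundamentalRep (Fin N) ℂ) U 0)⁻¹
       ((∑ a : Fin N, G (x, a) (x, a)) * (∑ b : Fin N, G (y, b) (y, b)) -
          ∑ a : Fin N, ∑ b : Fin N, G (x, a) (y, b) * G (y, b) (x, a)).re)
      ∂(wilsonWeight (d := ν) (L := L) (unitaryFundamentalRep (Fin N) ℂ) β)) / Z with hKdef
  have hκ : 0 ≤ κ := by
    have : (0 : ℝ) ≤ 1 / N + C * β := by positivity
    positivity
  have hZpos : 0 < Z := StrongCoupling.integral_det_D0_re_wilsonWeight_pos hL β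
  -- structure of the kernel at every `β`
  have hTPK := twoPointKernelStructure_proof N ν hN1 (by omega) L hL.two_dvd β
  dsimp only at hTPK
  obtain ⟨hS, hT, -⟩ := hTPK
  have hS' : ∀ x y, K x y = K y x := hS
  have hT' : ∀ x y a, K (x + a) (y + a) = K x y := fun x y a => hT a x y
  -- the Gaussian-domination form of the infrared bound, for every real `φ`
  have hA : ∀ φ : TorusSite ν L → ℝ,
      ∑ x, ∑ y, stencil (-1) φ x * K x y * stencil (-1) φ y ≤ κ * ∑ x, φ x * stencil (-1) φ x := by
    intro φ
    obtain ⟨p, hp, hp0, hp2⟩ := hW N ν L β φ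
    set q : ℝ := ∑ x, φ x * (-laplacian φ x) with hqdef
    -- Gaussian domination along the ray `s • φ`
    have hray : ∀ s : ℝ, p.eval s ≤ Z * Real.exp (κ * q / 2 * s ^ 2) := by
      intro s
      have h1 := hGD' β hβ hββ₀ L hL hL4 (s • φ)
      simp only [neg_laplacian_smul, Pi.smul_apply, smul_eq_mul] at h1
      rw [hp s] at h1
      have hexp : (2 * (N : ℝ)) ^ 2 * (1 / N + C * β) * (∑ x, s * φ x * (s * -laplacian φ x)) / 2 =
          κ * q / 2 * s ^ 2 := by
        rw [hqdef]
        simp only [Finset.mul_sum, Finset.sum_div, Finset.sum_mul]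
        refine Finset.sum_congr rfl fun x _ => ?_
        ring
      rw [hexp] at h1
      rw [mul_comm]
      exact (div_le_iff₀ hZpos).1 h1
    have h2 := coeff_two_le_of_eval_le_mul_exp hZpos.le hp0 hray
    rw [hp2] at h2
    -- divide by `Z > 0`
    have h3 : ∑ x, ∑ y, (-laplacian φ x) * (-laplacian φ y) * K x y ≤ κ * q := by
      have e : ∑ x, ∑ y, (-laplacian φ x) * (-laplacian φ y) * K x y =
          (∑ x, ∑ y, (-laplacian φ x) * (-laplacian φ y) *
            ∫ U, (Matrix.det (staggeredDirac (unitaryFundamentalRep (Fin N) ℂ) U 0)).re *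
              (let G := (staggeredDirac (unitaryFundamentalRep (Fin N) ℂ) U 0)⁻¹
               ((∑ a : Fin N, G (x, a) (x, a)) * (∑ b : Fin N, G (y, b) (y, b)) -
                  ∑ a : Fin N, ∑ b : Fin N, G (x, a) (y, b) * G (y, b) (x, a)).re)
              ∂(wilsonWeight (d := ν) (L := L) (unitaryFundamentalRep (Fin N) ℂ) β)) / Z := by
        rw [Finset.sum_div]
        refine Finset.sum_congr rfl fun x _ => ?_
        rw [Finset.sum_div]
        refine Finset.sum_congr rfl fun y _ => ?_
        rw [hKdef, mul_div_assoc]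
      rw [e, div_le_iff₀ hZpos]
      linarith
    simp only [stencil_neg_one]
    have e' : ∑ x, ∑ y, (-laplacian φ x) * K x y * (-laplacian φ y) =
        ∑ x, ∑ y, (-laplacian φ x) * (-laplacian φ y) * K x y :=
      Finset.sum_congr rfl fun x _ => Finset.sum_congr rfl fun y _ => by ring
    rw [e']
    exact h3
  -- the spectral step
  have hmain := form_le_of_stencil_form_le (s := -1) (by norm_num) hT' hS' hκ hA h
  simp only [stencil_neg_one] at hmain
  have e : ∑ x, ∑ y, h x * (-laplacian h y) * K x y = ∑ x, ∑ y, h x * K x y * (-laplacian h y) :=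
    Finset.sum_congr rfl fun x _ => Finset.sum_congr rfl fun y _ => by ring
  show ∑ x, ∑ y, h x * (-laplacian h y) * K x y ≤ κ * normSq h
  rw [e, ComplexSpin.normSq]
  exact hmain

end Summit.QuantumFields.QCD.Theorems.SmallBetaInfraredSplit
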